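/-
Copyright (c) 2026 the pub-hodgecm-mathlib formalisation cell (harness21).  Prover seat hodgecm-mathlib-K2Liu-p13 (g6): Track B «K2-LIT»,
#184♮ = hLiu418 = stmt-HodgeConjecture-24832, socket #41 KIND 1 a♮, `hGnb` road — hGnb-CHAIN DESK WORD #2 DEAL A (K2Liu-p23 (g4), 2026-09-05T04:14:44Z),
(P-good) road (A) «translate reduction», FILE (A-1): THE TWISTED LEVI ∕ UNIPOTENT REDUCTION OF THE LOCAL BIG-CELL INTEGRAL.
THEOREMS ONLY (no `def`, no `instance`, no notation, no named-fact hypothesis, no `sorry`); lane `--supports stmt-HodgeConjecture-24832 --as helper`.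
-/
import Summits.HodgeConjecture.HodgeConjecture.Theorems.K2LiuUnipDeltaConjugationModulus   -- ★ Φ8a (B): `map_conj_unipDeltaLocal_eq_smul` (the modulus); brings ★ Φ8a (A) `K2LiuLocalIntertwiningProperty`
import HarnessLib

/-!
# Crux `HLiu418`, socket #41 KIND 1 a♮, `hGnb` road, (P-good) road (A) FILE (A-1) — `K2LiuLocalTwistedSiegelReduction`:
# THE TWISTED LEVI ∕ UNIPOTENT REDUCTION `W_Ψ f (p·h) = |det_Δ p|_v^{n} · χ_s(w_Δ m w_Δ) · Ψ(m n₀⁻¹ m⁻¹) · W_{Ψ^m} f (h)`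

Cell `hodgecm-mathlib`, crux item hLiu418 = `stmt-HodgeConjecture-24832` (helper lane, count-neutral), route of record `HCCMUnconditional`; squad K2 ∕ K2Liu,
socket #41 `sig_K2LiuSiegelEisensteinContinuation`, KIND 1, block K1-a♮; hGnb-CHAIN desk K2Liu-p23 (g4), K1a (C-K) desk K2E4-p10 (g11); consumer: the (P-good)
growth letter `hPgood` of FILE C ED. 3 `K2LiuKindOneSingularLocalFaceOfRecordEdThree.locFace_letters_of_record₃` (road (A), census
`K2/K2Liu-p13/g6/CENSUS-Pgood-GoodPlaceTranslate.K2Liu-p13-g6.md` 6794442eb6482996, files (A-1)–(A-4)).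

THE MATHEMATICS ([Casselman1980, §3]; [HarrisKudlaSweet1996, §1 (1.11)–(1.15), §6 (6.14)]; [MoeglinWaldspurger1995, II.1.6–II.1.7]; [KudlaRallis1994, §2 (2.10)–(2.12)];
[Shimura1997, §18.3]).  `H(F_v) = U(𝕍 ⊕ −𝕍)(F_v)` (★ `UnitaryGroup.localPi E c (n + n) J^𝔻 v`), `P_Δ = M_Δ N_Δ` its Siegel parabolic (★ `IsSiegelDelta`, ★ D10
`unipDeltaLocal`), `w_Δ` (★ `weylDelta`).  For a twist `Ψ : N_Δ(F_v) → ℂ` and `f : H(F_v) → ℂ` the TWISTED big-cell integral is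
`W_Ψ f (h) = ∫_{N_Δ(F_v)} Ψ(u) · f(w_Δ u h) dνN(u)` — at `Ψ = conj ψ_β` and `f` a Siegel section this is the local factor of the `β`-th Fourier coefficient of the Siegel
Eisenstein series (the twisted twin of the local intertwining integral `M_v f = W_1 f`, ★ `localIntertwining`).  This file is the TWISTED TWIN of ★ Φ8a (A)
`K2LiuLocalIntertwiningProperty.isLocalSiegelSection_localIntertwining_of_modulus` (same substitutions, same absence of any integrability hypothesis):
* §1 **`integral_twist_mul_weylDelta_unip_mul`** — a UNIPOTENT translate comes out as a character value: for `Ψ` multiplicative and `n₀ ∈ N_Δ(F_v)`,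
  `W_Ψ f (n₀ h) = Ψ(n₀⁻¹) · W_Ψ f (h)` (left invariance of `νN` and commutativity of `N_Δ(F_v)`, ★ `mul_comm_of_mem_unipDeltaLocal`; ANY `f`).
* §2 **`integral_twist_mul_weylDelta_levi_mul_of_modulus`** — a LEVI translate conjugates the twist: for `m ∈ P_Δ(F_v)` with `B(m) = 0` and `f` a Siegel section
  of `I_v(s, χ_v)`, `W_Ψ f (m h) = |det_Δ m|_v^{n} · χ_v(det_Δ(w_Δ m w_Δ))|det_Δ(w_Δ m w_Δ)|^{s+n∕2} · W_{Ψ^m} f (h)` with `Ψ^m(u) = Ψ(m u m⁻¹)` (substitution `u ↦ m⁻¹ u m`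
  with the modulus `hmod` BY VALUE, then `w_Δ m u = (w_Δ m w_Δ)·(w_Δ u)` and the section law); **`…_levi_mul`** — the same with `hmod` PAID by ★ Φ8a (B)
  `map_conj_unipDeltaLocal_eq_smul` (`νN` Haar).
* §3 **`integral_twist_mul_weylDelta_levi_unip_mul`** — `p = m · n₀` (Levi decomposition BY VALUE): §2 ∘ §1, `W_Ψ f (m n₀ h) = |det_Δ m|^{n} · χ_s(w_Δ m w_Δ) ·
  Ψ^m(n₀⁻¹) · W_{Ψ^m} f (h)` (`Ψ^m` is again multiplicative, `conjTwist_mul`); **`exists_levi_unip_integral_twist_mul_weylDelta_siegel_mul`** — a GENERAL `p ∈ P_Δ(F_v)`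
  through ★ Φ8a (A) §2's Levi part (`adapt(matA m) = diag(A(p), D(p))`, ★ `blocks_matA_leviPart`, `n₀ = n(A⁻¹B)`), the blocks of `m` exported for the sequel.
* §4 `integral_twist_mul_weylDelta_mul_localInt` — a right-`K_v`-invariant `f` does not see a `K_v`-translate (pointwise; for the spherical section through the
  Iwasawa decomposition `H(F_v) = P_Δ(F_v)·K_v` this reduces EVERY translate to §3).
Every statement: generic rank `n`, every finite place, no integrability hypothesis (a measurable equivalence scaled by the modulus, a left translation).
NOT HERE (files (A-2)–(A-4) of the census): the corner-index transport under a triangular Levi block (LOCAL twist parameter `τ' = τ·N(a₁₁)^{±1}`), the local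
corner value at all orders, the heights, and the HEAD paying `hPgood`.

HONEST LABEL.  Count-neutral helper; it closes no socket by itself: `HC_CM` is proved only modulo the 7 printed citations (2 remaining named inputs:
hLiu418 = `stmt-HodgeConjecture-24832`, h413 = `stmt-HodgeConjecture-24833`) until rung 0 closes.

## References
* [Casselman1980] W. Casselman, *The unramified principal series of p-adic groups I*, Compositio Math. 40 (1980): §3 (`T_w`, Whittaker-type functionals on `I(χ)`).
* [HarrisKudlaSweet1996] M. Harris, S. Kudla, W. J. Sweet, *Theta dichotomy for unitary groups*, J. AMS 9 (1996): §1 (1.11)–(1.15), §6 (6.14)–(6.16).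
* [MoeglinWaldspurger1995] C. Mœglin, J.-L. Waldspurger, *Spectral decomposition and Eisenstein series*, CUP (1995): II.1.6–II.1.7.
* [KudlaRallis1994] S. Kudla, S. Rallis, *A regularized Siegel–Weil formula: the first term identity*, Ann. of Math. 140 (1994): §2 (2.10)–(2.12).
* [Shimura1997] G. Shimura, *Euler Products and Eisenstein Series*, CBMS 93 (1997): §18.3 (local Whittaker-type integrals of Siegel sections under `P`-translates).
-/

set_option autoImplicit false
set_option linter.dupNamespace false -- the mandated namespace repeats `HodgeConjecture.HodgeConjecture`

noncomputable section

open NumberField IsDedekindDomain Matrix MeasureTheory Topology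
open scoped NNReal ENNReal
open Literature.NumberTheory.Automorphic Literature.NumberTheory.Automorphic.UnitaryGroup
open Literature.NumberTheory.GelbartRogawski1991.AdaptedBlocks
open Literature.NumberTheory.GelbartRogawski1991.UnitaryDualPair.LocalSplitting
open Literature.NumberTheory.K2Lit.LocalSiegelDoubled
open Summit.HodgeConjecture.HodgeConjecture.Cruxes.HLiu418.K2LiuSiegelLeviWeylAlgebra
open Summit.HodgeConjecture.HodgeConjecture.Cruxes.HLiu418.K2LiuUnipDeltaLocalCoordinates
open Summit.HodgeConjecture.HodgeConjecture.Cruxes.HLiu418.K2LiuLocalSiegel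
open Summit.HodgeConjecture.HodgeConjecture.Cruxes.HLiu418.K2LiuLocalIntertwiningProperty
open Summit.HodgeConjecture.HodgeConjecture.Cruxes.HLiu418.K2LiuUnipDeltaConjugationModulus (map_conj_unipDeltaLocal_eq_smul)

namespace Summit.HodgeConjecture.HodgeConjecture.Cruxes.HLiu418.K2LiuLocalTwistedSiegelReduction

variable (F : Type) [Field F] [NumberField F] (E : Type) [Field E] [NumberField E] [Algebra F E]
  [Algebra.IsQuadraticExtension F E] (c : E ≃ₐ[F] E)
  {δ : E} (hcδ : c δ = -δ) (hδ : δ ≠ 0) {d : F} (hd : δ * δ = algebraMap F E d)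
  (v : HeightOneSpectrum (𝓞 F)) (n : ℕ) {T₀ : Matrix (Fin n) (Fin n) F} (hT₀ : T₀.IsSymm) (hT₀d : IsUnit T₀.det)
  {JD : Matrix (Fin (n + n)) (Fin (n + n)) E} (hJD : JD = (gramD F n T₀).map (algebraMap F E))

/-! ## §1 A unipotent translate: `W_Ψ f (n₀ h) = Ψ(n₀⁻¹) · W_Ψ f (h)` -/

omit [Algebra.IsQuadraticExtension F E] in
/-- **A UNIPOTENT TRANSLATE COMES OUT AS A CHARACTER VALUE.**  For a left-invariant measure `νN` on `N_Δ(F_v)`, a multiplicative twist `Ψ : N_Δ(F_v) → ℂ`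
(`Ψ(u u') = Ψ(u) Ψ(u')`), ANY `f : H(F_v) → ℂ`, `n₀ ∈ N_Δ(F_v)` and `h ∈ H(F_v)`:
`∫ Ψ(u) f(w_Δ u (n₀ h)) dνN(u) = Ψ(n₀⁻¹) · ∫ Ψ(u) f(w_Δ u h) dνN(u)` — substitute `u ↦ n₀⁻¹ u` (left invariance) and use that `N_Δ(F_v)` is commutative
(★ `mul_comm_of_mem_unipDeltaLocal`), so `(n₀⁻¹ u) n₀ = u`; no integrability is needed (both sides carry the same junk value).
[cite: Casselman1980, §3] [cite: Shimura1997, §18.3] [cite: MoeglinWaldspurger1995, II.1.7] -/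
theorem integral_twist_mul_weylDelta_unip_mul
    [MeasurableSpace (unipDeltaLocal F E c v n (JD := JD))] [BorelSpace (unipDeltaLocal F E c v n (JD := JD))]
    (νN : Measure (unipDeltaLocal F E c v n (JD := JD))) [νN.IsMulLeftInvariant]
    (Ψ : unipDeltaLocal F E c v n (JD := JD) → ℂ) (hΨ : ∀ u u', Ψ (u * u') = Ψ u * Ψ u')
    (f : UnitaryGroup.localPi E c (n + n) JD v → ℂ) (n₀ : unipDeltaLocal F E c v n (JD := JD)) (h : UnitaryGroup.localPi E c (n + n) JD v) :
    ∫ u, Ψ u * f (weylDelta F E c v n hJD * (u : UnitaryGroup.localPi E c (n + n) JD v) * ((n₀ : UnitaryGroup.localPi E c (n + n) JD v) * h)) ∂νN =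
      Ψ n₀⁻¹ * ∫ u, Ψ u * f (weylDelta F E c v n hJD * (u : UnitaryGroup.localPi E c (n + n) JD v) * h) ∂νN := by
  rw [← integral_const_mul, ← integral_mul_left_eq_self (fun u : unipDeltaLocal F E c v n (JD := JD) =>
    Ψ u * f (weylDelta F E c v n hJD * (u : UnitaryGroup.localPi E c (n + n) JD v) * ((n₀ : UnitaryGroup.localPi E c (n + n) JD v) * h))) n₀⁻¹]
  refine integral_congr_ae (Filter.Eventually.of_forall fun u => ?_)
  show Ψ (n₀⁻¹ * u) * f (weylDelta F E c v n hJD * ((n₀⁻¹ * u : unipDeltaLocal F E c v n (JD := JD)) : UnitaryGroup.localPi E c (n + n) JD v) *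
      ((n₀ : UnitaryGroup.localPi E c (n + n) JD v) * h)) =
    Ψ n₀⁻¹ * (Ψ u * f (weylDelta F E c v n hJD * (u : UnitaryGroup.localPi E c (n + n) JD v) * h))
  rw [hΨ, mul_assoc]
  congr 2
  -- `(n₀⁻¹ u) n₀ = u`: `N_Δ(F_v)` is commutative
  have hc : (u : UnitaryGroup.localPi E c (n + n) JD v) * (n₀ : UnitaryGroup.localPi E c (n + n) JD v) =
      (n₀ : UnitaryGroup.localPi E c (n + n) JD v) * (u : UnitaryGroup.localPi E c (n + n) JD v) :=
    mul_comm_of_mem_unipDeltaLocal F E c v n u.2 n₀.2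
  have h1 : ((n₀⁻¹ * u : unipDeltaLocal F E c v n (JD := JD)) : UnitaryGroup.localPi E c (n + n) JD v) =
      (n₀ : UnitaryGroup.localPi E c (n + n) JD v)⁻¹ * (u : UnitaryGroup.localPi E c (n + n) JD v) := rfl
  rw [h1]
  congr 1
  calc weylDelta F E c v n hJD * ((n₀ : UnitaryGroup.localPi E c (n + n) JD v)⁻¹ * (u : UnitaryGroup.localPi E c (n + n) JD v)) *
        ((n₀ : UnitaryGroup.localPi E c (n + n) JD v) * h) =
      weylDelta F E c v n hJD * ((n₀ : UnitaryGroup.localPi E c (n + n) JD v)⁻¹ *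
        ((u : UnitaryGroup.localPi E c (n + n) JD v) * (n₀ : UnitaryGroup.localPi E c (n + n) JD v))) * h := by simp only [mul_assoc]
    _ = weylDelta F E c v n hJD * (u : UnitaryGroup.localPi E c (n + n) JD v) * h := by rw [hc, inv_mul_cancel_left]

/-! ## §2 A Levi translate conjugates the twist: `W_Ψ f (m h) = |det_Δ m|^{n} · χ_s(w_Δ m w_Δ) · W_{Ψ^m} f (h)` -/

/-- **A LEVI TRANSLATE, GIVEN THE MODULUS.**  Let `νN` be a measure on `N_Δ(F_v)` whose push-forward under each conjugation `u ↦ q u q⁻¹`, `q ∈ P_Δ(F_v)`,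
is `|det_Δ q|_v^{−n} • νN` (`hmod`, ★ Φ8a (A)'s binder VERBATIM; paid by ★ Φ8a (B) below), `Ψ : N_Δ(F_v) → ℂ` ANY twist, `f` a Siegel section of `I_v(s, χ_v)`
(★ `IsLocalSiegelSection`), `m ∈ P_Δ(F_v)` a LEVI element (`B(m) = 0`).  Then for every `h`:
`∫ Ψ(u) f(w_Δ u (m h)) dνN = |det_Δ m|_v^{n} · χ_v(det_Δ(w_Δ m w_Δ))|det_Δ(w_Δ m w_Δ)|_v^{s+n∕2} · ∫ Ψ(m u m⁻¹) f(w_Δ u h) dνN` — substitute `u = m u' m⁻¹`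
(`hmod` at `m⁻¹`: factor `|det_Δ m|^{n}`), then `w_Δ m u' = (w_Δ m w_Δ)(w_Δ u')` (`w_Δ² = 1`) and the section law at `w_Δ m w_Δ ∈ P_Δ(F_v)` (★ `isSiegelDelta_weylDelta_conj`).
No integrability hypothesis. [cite: Casselman1980, §3] [cite: HarrisKudlaSweet1996, §1 (1.15), §6 (6.14)] [cite: MoeglinWaldspurger1995, II.1.6] [cite: Shimura1997, §18.3] -/
theorem integral_twist_mul_weylDelta_levi_mul_of_modulus
    [MeasurableSpace (unipDeltaLocal F E c v n (JD := JD))] [BorelSpace (unipDeltaLocal F E c v n (JD := JD))]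
    (νN : Measure (unipDeltaLocal F E c v n (JD := JD)))
    (hmod : ∀ (q : UnitaryGroup.localPi E c (n + n) JD v) (hq : IsSiegelDelta F E c hcδ hδ hd v n hT₀ hJD q),
      Measure.map (fun u : unipDeltaLocal F E c v n (JD := JD) =>
        (⟨q * (u : UnitaryGroup.localPi E c (n + n) JD v) * q⁻¹, conj_mem_unipDeltaLocal F E c hcδ hδ hd v n hT₀ hJD hq u.2⟩ :
          unipDeltaLocal F E c v n (JD := JD))) νN =
        ENNReal.ofReal ((absDetDelta F E c v n q ^ n)⁻¹) • νN)
    (χv : ∀ w : PlacesOver E v, (w.1.adicCompletion E)ˣ →* ℂˣ) (s : ℂ)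
    {f : UnitaryGroup.localPi E c (n + n) JD v → ℂ} (hf : IsLocalSiegelSection F E c hcδ hδ hd v n hT₀ hJD χv s f)
    (Ψ : unipDeltaLocal F E c v n (JD := JD) → ℂ)
    {m : UnitaryGroup.localPi E c (n + n) JD v} (hm : IsSiegelDelta F E c hcδ hδ hd v n hT₀ hJD m) (hmB : blkB (matA F E c v n m) = 0)
    (h : UnitaryGroup.localPi E c (n + n) JD v) :
    ∫ u, Ψ u * f (weylDelta F E c v n hJD * (u : UnitaryGroup.localPi E c (n + n) JD v) * (m * h)) ∂νN =
      ((absDetDelta F E c v n m ^ n : ℝ) : ℂ) *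
        (localSiegelCharacter F E c v n χv s (weylDelta F E c v n hJD * m * weylDelta F E c v n hJD) *
          ∫ u, Ψ ⟨m * (u : UnitaryGroup.localPi E c (n + n) JD v) * m⁻¹, conj_mem_unipDeltaLocal F E c hcδ hδ hd v n hT₀ hJD hm u.2⟩ *
            f (weylDelta F E c v n hJD * (u : UnitaryGroup.localPi E c (n + n) JD v) * h) ∂νN) := by
  classical
  have hmC := (isSiegelDelta_iff_blkC_eq_zero F E c hcδ hδ hd v n hT₀ hJD m).1 hm
  have hwmw : IsSiegelDelta F E c hcδ hδ hd v n hT₀ hJD (weylDelta F E c v n hJD * m * weylDelta F E c v n hJD) :=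
    isSiegelDelta_weylDelta_conj F E c hcδ hδ hd v n hT₀ hJD hmC hmB
  -- the conjugated twist `Ψ^m` and the transported integrand `G`
  set Ψ' : unipDeltaLocal F E c v n (JD := JD) → ℂ := fun u =>
    Ψ ⟨m * (u : UnitaryGroup.localPi E c (n + n) JD v) * m⁻¹, conj_mem_unipDeltaLocal F E c hcδ hδ hd v n hT₀ hJD hm u.2⟩ with hΨ'
  set G : unipDeltaLocal F E c v n (JD := JD) → ℂ := fun u =>
    Ψ' u * f (weylDelta F E c v n hJD * (m * (u : UnitaryGroup.localPi E c (n + n) JD v)) * h) with hG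
  -- Step 1: `u = m (m⁻¹ u m) m⁻¹` and the modulus at `m⁻¹`
  obtain ⟨e, he⟩ := exists_homeomorph_conj F E c hcδ hδ hd v n hT₀ hJD hm.inv
  have hmap : Measure.map e νN = ENNReal.ofReal ((absDetDelta F E c v n m⁻¹ ^ n)⁻¹) • νN := by
    rw [show (⇑e) = fun u : unipDeltaLocal F E c v n (JD := JD) =>
        (⟨m⁻¹ * (u : UnitaryGroup.localPi E c (n + n) JD v) * m⁻¹⁻¹, conj_mem_unipDeltaLocal F E c hcδ hδ hd v n hT₀ hJD hm.inv u.2⟩ :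
          unipDeltaLocal F E c v n (JD := JD)) from funext he]
    exact hmod m⁻¹ hm.inv
  have h1 : ∫ u, Ψ u * f (weylDelta F E c v n hJD * (u : UnitaryGroup.localPi E c (n + n) JD v) * (m * h)) ∂νN = ∫ u, G (e u) ∂νN := by
    refine integral_congr_ae (Filter.Eventually.of_forall fun u => ?_)
    show Ψ u * f (weylDelta F E c v n hJD * (u : UnitaryGroup.localPi E c (n + n) JD v) * (m * h)) =
      Ψ' (e u) * f (weylDelta F E c v n hJD * (m * ((e u : unipDeltaLocal F E c v n (JD := JD)) : UnitaryGroup.localPi E c (n + n) JD v)) * h)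
    have hu : Ψ u = Ψ' (e u) := by
      rw [hΨ']
      refine congrArg Ψ (Subtype.ext ?_)
      show (u : UnitaryGroup.localPi E c (n + n) JD v) =
        m * ((e u : unipDeltaLocal F E c v n (JD := JD)) : UnitaryGroup.localPi E c (n + n) JD v) * m⁻¹
      rw [he u]
      show (u : UnitaryGroup.localPi E c (n + n) JD v) = m * (m⁻¹ * (u : UnitaryGroup.localPi E c (n + n) JD v) * m⁻¹⁻¹) * m⁻¹
      rw [inv_inv]; group
    rw [hu, he u]
    show Ψ' _ * f (weylDelta F E c v n hJD * (u : UnitaryGroup.localPi E c (n + n) JD v) * (m * h)) =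
      Ψ' _ * f (weylDelta F E c v n hJD * (m * (m⁻¹ * (u : UnitaryGroup.localPi E c (n + n) JD v) * m⁻¹⁻¹)) * h)
    congr 2
    rw [inv_inv]; group
  have h2 : ∫ u, G (e u) ∂νN = (absDetDelta F E c v n m ^ n : ℝ) • ∫ u, G u ∂νN := by
    have h := integral_map_equiv (μ := νN) e.toMeasurableEquiv G
    rw [Homeomorph.toMeasurableEquiv_coe, hmap, integral_smul_measure,
      ENNReal.toReal_ofReal (inv_nonneg.2 (pow_nonneg (absDetDelta_nonneg F E c v n _) _)), absDetDelta_inv F E c hcδ hδ hd v n hT₀ hJD hm,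
      inv_pow, inv_inv] at h
    exact h.symm
  -- Step 2: `w_Δ m u = (w_Δ m w_Δ) · (w_Δ u)` and the section law at `w_Δ m w_Δ`
  have hw2 := weylDelta_mul_self F E c v n hJD (T₀ := T₀)
  have key : ∀ a b b' : UnitaryGroup.localPi E c (n + n) JD v,
      weylDelta F E c v n hJD * a * weylDelta F E c v n hJD * (weylDelta F E c v n hJD * b * b') = weylDelta F E c v n hJD * (a * b) * b' := by
    intro a b b'
    have h' : weylDelta F E c v n hJD * a * weylDelta F E c v n hJD * (weylDelta F E c v n hJD * b * b') =
        weylDelta F E c v n hJD * a * (weylDelta F E c v n hJD * weylDelta F E c v n hJD) * (b * b') := by simp only [mul_assoc]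
    rw [h', hw2, mul_one]
    simp only [mul_assoc]
  have h3 : ∫ u, G u ∂νN = localSiegelCharacter F E c v n χv s (weylDelta F E c v n hJD * m * weylDelta F E c v n hJD) *
      ∫ u, Ψ' u * f (weylDelta F E c v n hJD * (u : UnitaryGroup.localPi E c (n + n) JD v) * h) ∂νN := by
    rw [← integral_const_mul]
    refine integral_congr_ae (Filter.Eventually.of_forall fun u => ?_)
    show Ψ' u * f (weylDelta F E c v n hJD * (m * (u : UnitaryGroup.localPi E c (n + n) JD v)) * h) =
      localSiegelCharacter F E c v n χv s (weylDelta F E c v n hJD * m * weylDelta F E c v n hJD) *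
        (Ψ' u * f (weylDelta F E c v n hJD * (u : UnitaryGroup.localPi E c (n + n) JD v) * h))
    rw [← key m (u : UnitaryGroup.localPi E c (n + n) JD v) h, hf _ hwmw, mul_left_comm]
  -- Step 3: the scalars
  rw [h1, h2, h3, Complex.real_smul]

include hT₀d in
/-- **A LEVI TRANSLATE CONJUGATES THE TWIST** (the modulus PAID, ★ Φ8a (B) `map_conj_unipDeltaLocal_eq_smul`; `νN` ANY Haar measure on `N_Δ(F_v)`): for a Siegel
section `f` of `I_v(s, χ_v)`, ANY twist `Ψ`, a Levi element `m` (`m ∈ P_Δ(F_v)`, `B(m) = 0`) and every `h`,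
`∫ Ψ(u) f(w_Δ u (m h)) dνN = |det_Δ m|_v^{n} · χ_v(det_Δ(w_Δ m w_Δ))|det_Δ(w_Δ m w_Δ)|_v^{s+n∕2} · ∫ Ψ(m u m⁻¹) f(w_Δ u h) dνN`.
[cite: Casselman1980, §3] [cite: HarrisKudlaSweet1996, §1 (1.12), (1.15), §6 (6.14)] [cite: MoeglinWaldspurger1995, II.1.6] -/
theorem integral_twist_mul_weylDelta_levi_mul
    [MeasurableSpace (unipDeltaLocal F E c v n (JD := JD))] [BorelSpace (unipDeltaLocal F E c v n (JD := JD))]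
    (νN : Measure (unipDeltaLocal F E c v n (JD := JD))) [νN.IsHaarMeasure]
    (χv : ∀ w : PlacesOver E v, (w.1.adicCompletion E)ˣ →* ℂˣ) (s : ℂ)
    {f : UnitaryGroup.localPi E c (n + n) JD v → ℂ} (hf : IsLocalSiegelSection F E c hcδ hδ hd v n hT₀ hJD χv s f)
    (Ψ : unipDeltaLocal F E c v n (JD := JD) → ℂ)
    {m : UnitaryGroup.localPi E c (n + n) JD v} (hm : IsSiegelDelta F E c hcδ hδ hd v n hT₀ hJD m) (hmB : blkB (matA F E c v n m) = 0)
    (h : UnitaryGroup.localPi E c (n + n) JD v) :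
    ∫ u, Ψ u * f (weylDelta F E c v n hJD * (u : UnitaryGroup.localPi E c (n + n) JD v) * (m * h)) ∂νN =
      ((absDetDelta F E c v n m ^ n : ℝ) : ℂ) *
        (localSiegelCharacter F E c v n χv s (weylDelta F E c v n hJD * m * weylDelta F E c v n hJD) *
          ∫ u, Ψ ⟨m * (u : UnitaryGroup.localPi E c (n + n) JD v) * m⁻¹, conj_mem_unipDeltaLocal F E c hcδ hδ hd v n hT₀ hJD hm u.2⟩ *
            f (weylDelta F E c v n hJD * (u : UnitaryGroup.localPi E c (n + n) JD v) * h) ∂νN) :=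
  integral_twist_mul_weylDelta_levi_mul_of_modulus F E c hcδ hδ hd v n hT₀ hJD νN
    (fun _ hq => map_conj_unipDeltaLocal_eq_smul F E c hcδ hδ hd v n hT₀ hT₀d hJD νN hq) χv s hf Ψ hm hmB h

/-! ## §3 A general `p ∈ P_Δ(F_v)`: the Levi part and the unipotent part -/

/-- the conjugated twist `Ψ^q(u) = Ψ(q u q⁻¹)` of a multiplicative twist is multiplicative (`q ∈ P_Δ(F_v)`; conjugation is a group homomorphism of `N_Δ(F_v)`).
[cite: HarrisKudlaSweet1996, §1 (1.12)] -/
theorem conjTwist_mul (Ψ : unipDeltaLocal F E c v n (JD := JD) → ℂ) (hΨ : ∀ u u', Ψ (u * u') = Ψ u * Ψ u')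
    {q : UnitaryGroup.localPi E c (n + n) JD v} (hq : IsSiegelDelta F E c hcδ hδ hd v n hT₀ hJD q) (u u' : unipDeltaLocal F E c v n (JD := JD)) :
    Ψ ⟨q * ((u * u' : unipDeltaLocal F E c v n (JD := JD)) : UnitaryGroup.localPi E c (n + n) JD v) * q⁻¹,
        conj_mem_unipDeltaLocal F E c hcδ hδ hd v n hT₀ hJD hq (u * u').2⟩ =
      Ψ ⟨q * (u : UnitaryGroup.localPi E c (n + n) JD v) * q⁻¹, conj_mem_unipDeltaLocal F E c hcδ hδ hd v n hT₀ hJD hq u.2⟩ *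
        Ψ ⟨q * (u' : UnitaryGroup.localPi E c (n + n) JD v) * q⁻¹, conj_mem_unipDeltaLocal F E c hcδ hδ hd v n hT₀ hJD hq u'.2⟩ := by
  rw [← hΨ]
  refine congrArg Ψ (Subtype.ext ?_)
  show q * ((u : UnitaryGroup.localPi E c (n + n) JD v) * (u' : UnitaryGroup.localPi E c (n + n) JD v)) * q⁻¹ =
    q * (u : UnitaryGroup.localPi E c (n + n) JD v) * q⁻¹ * (q * (u' : UnitaryGroup.localPi E c (n + n) JD v) * q⁻¹)
  group

include hT₀d in
/-- **THE TWISTED LEVI ∕ UNIPOTENT REDUCTION FOR `p = m · n₀ ∈ P_Δ(F_v)`** (Levi decomposition BY VALUE: `m ∈ P_Δ(F_v)` with `B(m) = 0`, `n₀ ∈ N_Δ(F_v)`; for a general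
`p ∈ P_Δ(F_v)` take `m := p · n(A⁻¹B)⁻¹`, `n₀ := n(A⁻¹B)` — ★ Φ8a (A) §2 `isSiegelDelta_leviPart`, `blocks_matA_leviPart` (`adapt(matA m) = diag(A(p), D(p))`),
`p = m n₀` by `inv_mul_cancel_right`).  `νN` Haar on `N_Δ(F_v)`, `Ψ : N_Δ(F_v) → ℂ` multiplicative, `f` a Siegel section of `I_v(s, χ_v)`.  Then for every `h`:
`∫ Ψ(u) f(w_Δ u (m n₀ h)) dνN = |det_Δ m|_v^{n} · χ_v(det_Δ(w_Δ m w_Δ))|det_Δ(w_Δ m w_Δ)|_v^{s+n∕2} · Ψ(m n₀⁻¹ m⁻¹) · ∫ Ψ(m u m⁻¹) f(w_Δ u h) dνN` (§2, then §1 for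
the multiplicative conjugated twist `Ψ^m`, ★ `conjTwist_mul`).  At `Ψ = 1` this is ★ Φ8a (A); at `Ψ = conj ψ_β` it is the classical
`W_β(f)(m n h) = ψ-value · |det|^{n} · χ_s(w m w) · W_{β[m]}(f)(h)`.
[cite: Casselman1980, §3] [cite: HarrisKudlaSweet1996, §1 (1.11)–(1.15), §6 (6.14)] [cite: MoeglinWaldspurger1995, II.1.6–II.1.7] [cite: KudlaRallis1994, §2 (2.10)–(2.12)] [cite: Shimura1997, §18.3] -/
theorem integral_twist_mul_weylDelta_levi_unip_mul
    [MeasurableSpace (unipDeltaLocal F E c v n (JD := JD))] [BorelSpace (unipDeltaLocal F E c v n (JD := JD))]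
    (νN : Measure (unipDeltaLocal F E c v n (JD := JD))) [νN.IsHaarMeasure]
    (χv : ∀ w : PlacesOver E v, (w.1.adicCompletion E)ˣ →* ℂˣ) (s : ℂ)
    {f : UnitaryGroup.localPi E c (n + n) JD v → ℂ} (hf : IsLocalSiegelSection F E c hcδ hδ hd v n hT₀ hJD χv s f)
    (Ψ : unipDeltaLocal F E c v n (JD := JD) → ℂ) (hΨ : ∀ u u', Ψ (u * u') = Ψ u * Ψ u')
    {m : UnitaryGroup.localPi E c (n + n) JD v} (hm : IsSiegelDelta F E c hcδ hδ hd v n hT₀ hJD m) (hmB : blkB (matA F E c v n m) = 0)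
    (n₀ : unipDeltaLocal F E c v n (JD := JD)) (h : UnitaryGroup.localPi E c (n + n) JD v) :
    ∫ u, Ψ u * f (weylDelta F E c v n hJD * (u : UnitaryGroup.localPi E c (n + n) JD v) * (m * (n₀ : UnitaryGroup.localPi E c (n + n) JD v) * h)) ∂νN =
      ((absDetDelta F E c v n m ^ n : ℝ) : ℂ) *
        (localSiegelCharacter F E c v n χv s (weylDelta F E c v n hJD * m * weylDelta F E c v n hJD) *
          (Ψ ⟨m * ((n₀⁻¹ : unipDeltaLocal F E c v n (JD := JD)) : UnitaryGroup.localPi E c (n + n) JD v) * m⁻¹,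
              conj_mem_unipDeltaLocal F E c hcδ hδ hd v n hT₀ hJD hm n₀⁻¹.2⟩ *
            ∫ u, Ψ ⟨m * (u : UnitaryGroup.localPi E c (n + n) JD v) * m⁻¹, conj_mem_unipDeltaLocal F E c hcδ hδ hd v n hT₀ hJD hm u.2⟩ *
              f (weylDelta F E c v n hJD * (u : UnitaryGroup.localPi E c (n + n) JD v) * h) ∂νN)) := by
  -- §2 at the Levi part `m`, translate `n₀ h`
  have h1 : ∫ u, Ψ u * f (weylDelta F E c v n hJD * (u : UnitaryGroup.localPi E c (n + n) JD v) *
        (m * (n₀ : UnitaryGroup.localPi E c (n + n) JD v) * h)) ∂νN =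
      ∫ u, Ψ u * f (weylDelta F E c v n hJD * (u : UnitaryGroup.localPi E c (n + n) JD v) *
        (m * ((n₀ : UnitaryGroup.localPi E c (n + n) JD v) * h))) ∂νN := by
    refine integral_congr_ae (Filter.Eventually.of_forall fun u => ?_)
    show Ψ u * f (weylDelta F E c v n hJD * (u : UnitaryGroup.localPi E c (n + n) JD v) * (m * (n₀ : UnitaryGroup.localPi E c (n + n) JD v) * h)) =
      Ψ u * f (weylDelta F E c v n hJD * (u : UnitaryGroup.localPi E c (n + n) JD v) * (m * ((n₀ : UnitaryGroup.localPi E c (n + n) JD v) * h)))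
    rw [mul_assoc m]
  rw [h1, integral_twist_mul_weylDelta_levi_mul F E c hcδ hδ hd v n hT₀ hT₀d hJD νN χv s hf Ψ hm hmB]
  -- §1 for the conjugated twist `Ψ^m`, translate `h`
  rw [integral_twist_mul_weylDelta_unip_mul F E c v n hJD νN _ (conjTwist_mul F E c hcδ hδ hd v n hT₀ hJD Ψ hΨ hm) f n₀ h]

include hT₀d in
/-- **THE SAME FOR A GENERAL `p ∈ P_Δ(F_v)`**, the Levi decomposition taken from ★ Φ8a (A) §2 (`m := p · n(A⁻¹B)⁻¹`, `n₀ := n(A⁻¹B)`), in the shape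
«there are a Levi `m` with the blocks `A(p)`, `D(p)` and a unipotent `n₀` with `p = m n₀` for which §3 holds» — the blocks of `m` are what the corner-index
transport of the sequel (A-2) reads. [cite: HarrisKudlaSweet1996, §1 (1.11)–(1.15)] [cite: MoeglinWaldspurger1995, II.1.6–II.1.7] [cite: Casselman1980, §3] -/
theorem exists_levi_unip_integral_twist_mul_weylDelta_siegel_mul
    [MeasurableSpace (unipDeltaLocal F E c v n (JD := JD))] [BorelSpace (unipDeltaLocal F E c v n (JD := JD))]
    (νN : Measure (unipDeltaLocal F E c v n (JD := JD))) [νN.IsHaarMeasure]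
    (χv : ∀ w : PlacesOver E v, (w.1.adicCompletion E)ˣ →* ℂˣ) (s : ℂ)
    {f : UnitaryGroup.localPi E c (n + n) JD v → ℂ} (hf : IsLocalSiegelSection F E c hcδ hδ hd v n hT₀ hJD χv s f)
    (Ψ : unipDeltaLocal F E c v n (JD := JD) → ℂ) (hΨ : ∀ u u', Ψ (u * u') = Ψ u * Ψ u')
    {p : UnitaryGroup.localPi E c (n + n) JD v} (hp : IsSiegelDelta F E c hcδ hδ hd v n hT₀ hJD p) :
    ∃ (m : UnitaryGroup.localPi E c (n + n) JD v) (hm : IsSiegelDelta F E c hcδ hδ hd v n hT₀ hJD m) (n₀ : unipDeltaLocal F E c v n (JD := JD)),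
      blkA (matA F E c v n m) = blkA (matA F E c v n p) ∧ blkB (matA F E c v n m) = 0 ∧ blkD (matA F E c v n m) = blkD (matA F E c v n p) ∧
      p = m * (n₀ : UnitaryGroup.localPi E c (n + n) JD v) ∧
      ∀ h : UnitaryGroup.localPi E c (n + n) JD v,
        ∫ u, Ψ u * f (weylDelta F E c v n hJD * (u : UnitaryGroup.localPi E c (n + n) JD v) * (p * h)) ∂νN =
          ((absDetDelta F E c v n m ^ n : ℝ) : ℂ) *
            (localSiegelCharacter F E c v n χv s (weylDelta F E c v n hJD * m * weylDelta F E c v n hJD) *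
              (Ψ ⟨m * ((n₀⁻¹ : unipDeltaLocal F E c v n (JD := JD)) : UnitaryGroup.localPi E c (n + n) JD v) * m⁻¹,
                  conj_mem_unipDeltaLocal F E c hcδ hδ hd v n hT₀ hJD hm n₀⁻¹.2⟩ *
                ∫ u, Ψ ⟨m * (u : UnitaryGroup.localPi E c (n + n) JD v) * m⁻¹, conj_mem_unipDeltaLocal F E c hcδ hδ hd v n hT₀ hJD hm u.2⟩ *
                  f (weylDelta F E c v n hJD * (u : UnitaryGroup.localPi E c (n + n) JD v) * h) ∂νN)) := by
  have hC := (isSiegelDelta_iff_blkC_eq_zero F E c hcδ hδ hd v n hT₀ hJD p).1 hp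
  obtain ⟨hA, hB, -, hD⟩ := blocks_matA_leviPart F E c v n hJD hC
  refine ⟨_, isSiegelDelta_leviPart F E c hcδ hδ hd v n hT₀ hJD hp,
    ⟨nElem F E c v n hJD _ (skew_blkA_inv_mul_blkB F E c v n hJD hC), nElem_mem_unipDeltaLocal F E c v n hJD _ _⟩, hA, hB, hD,
    (inv_mul_cancel_right p _).symm, fun h => ?_⟩
  rw [← integral_twist_mul_weylDelta_levi_unip_mul F E c hcδ hδ hd v n hT₀ hT₀d hJD νN χv s hf Ψ hΨ (isSiegelDelta_leviPart F E c hcδ hδ hd v n hT₀ hJD hp) hB]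
  refine integral_congr_ae (Filter.Eventually.of_forall fun u => ?_)
  show Ψ u * f (weylDelta F E c v n hJD * (u : UnitaryGroup.localPi E c (n + n) JD v) * (p * h)) =
    Ψ u * f (weylDelta F E c v n hJD * (u : UnitaryGroup.localPi E c (n + n) JD v) * (p * (nElem F E c v n hJD _ (skew_blkA_inv_mul_blkB F E c v n hJD hC))⁻¹ *
      nElem F E c v n hJD _ (skew_blkA_inv_mul_blkB F E c v n hJD hC) * h))
  rw [inv_mul_cancel_right]

/-! ## §4 A `K_v`-translate of a right-`K_v`-invariant function -/

omit [Algebra.IsQuadraticExtension F E] in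
/-- **a right-`K_v`-invariant `f` does not see a `K_v`-translate** under the twisted big-cell integral (pointwise under the integral; any measure, any twist).
Through the Iwasawa decomposition `H(F_v) = P_Δ(F_v) · K_v` (★ `K2LiuLocalSiegelIwasawa.exists_isSiegelDelta_mul_mem_localInt`) this and §3 reduce EVERY
translate of the twisted big-cell integral of a spherical section to the integral at `h = 1` with a conjugated twist. [cite: Casselman1980, §3] [cite: HarrisKudlaSweet1996, §6 (6.14)] -/
theorem integral_twist_mul_weylDelta_mul_localInt [MeasurableSpace (unipDeltaLocal F E c v n (JD := JD))]
    (νN : Measure (unipDeltaLocal F E c v n (JD := JD))) (Ψ : unipDeltaLocal F E c v n (JD := JD) → ℂ)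
    {f : UnitaryGroup.localPi E c (n + n) JD v → ℂ}
    (hfK : ∀ k ∈ UnitaryGroup.localInt E c (n + n) JD v, ∀ g : UnitaryGroup.localPi E c (n + n) JD v, f (g * k) = f g)
    (x : UnitaryGroup.localPi E c (n + n) JD v) {k : UnitaryGroup.localPi E c (n + n) JD v} (hk : k ∈ UnitaryGroup.localInt E c (n + n) JD v) :
    ∫ u, Ψ u * f (weylDelta F E c v n hJD * (u : UnitaryGroup.localPi E c (n + n) JD v) * (x * k)) ∂νN =
      ∫ u, Ψ u * f (weylDelta F E c v n hJD * (u : UnitaryGroup.localPi E c (n + n) JD v) * x) ∂νN := by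
  refine integral_congr_ae (Filter.Eventually.of_forall fun u => ?_)
  show Ψ u * f (weylDelta F E c v n hJD * (u : UnitaryGroup.localPi E c (n + n) JD v) * (x * k)) =
    Ψ u * f (weylDelta F E c v n hJD * (u : UnitaryGroup.localPi E c (n + n) JD v) * x)
  rw [← mul_assoc, hfK k hk]

end Summit.HodgeConjecture.HodgeConjecture.Cruxes.HLiu418.K2LiuLocalTwistedSiegelReduction

end
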